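import Mathlib
import Literature.Probability.LatticeModels.ThermodynamicLimit
import Literature.Probability.LatticeModels.SharpnessProofs
import Summits.CriticalPhenomena.Ising3DConformalLimit.Theorems.PrecisionLaplacianDirectCorrelationStableTailTightnessAux
import HarnessLib

/-!
# Stub `stub_tightness` of line `diffusive-branch-is-nonsaturation` (crux
# `PrecisionLaplacian.DirectCorrelationStableTail`, stmt-CriticalPhenomena-4799): tightness of the
# rescaled jump measures (at infinity by the flux identity, at zero by the antitone slab sums)

Notation: `B_R = box 3 R = {−R,…,R}³ ⊆ ℤ³ = Site 3`, `‖·‖` the sup norm, `|y|₂² = Σ_i y_i²`, and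
for `i : Fin 3`, `n : ℕ` the slab sums `S_i(n) = Σ_{y⊥ ∈ ℤ²} m(insertNth i n y⊥)`.

**Statement** (registered text, = `stub_tightness` of the lead's skeleton).  Let `m ∈ ℓ¹(ℤ³)`,
`Σ m = 0`, `m ≥ 0` off `0`, `m` invariant under the coordinate sign flips, with antitone slab sums
`S_i(n+1) ≤ S_i(n)` (`n ≥ 1`), let `G ≥ 0` satisfy the precision identity
`Σ_y m(y) G(z − y) = −δ_{z0}`, box capture `Σ_{z∈B_R} G(z+v) ≤ Σ_{z∈B_R} G(z)` and the scale
bounds `G(x) ≤ C₁‖x‖^{α−3}` (`x ≠ 0`), `c₁‖x‖^{α−3} ≤ G(x)` (`‖x‖ ≥ R₀`), `1 < α < 2`, `c₁ > 0`.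
Then there are `C, C', R₁` with
(i) `R^α Σ_{y∈T} m(y) ≤ C` for every `R ≥ R₁` and every finite `T ⊆ {‖y‖ ≥ R}`;
(ii) `Σ_{y ∈ B_R} m(y)|y|₂² ≤ C' R^{2−α}` for every `R ≥ 1`.

**Proof.**  (i) is `tight_atInfinity` of the auxiliary file (flux identity + box capture + scale
bounds).  (ii):
* `tight_slab_block`: for `R ≥ max(R₁,1)`, `Σ_{j=R}^{n} S_i(j) ≤ C/R^α` — every finite piece
  `Σ_{y⊥ ∈ s} Σ_{j=R}^{n} m(insertNth i j y⊥)` is `Σ_{y∈T} m(y)` for the finite set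
  `T = insertNth i([R,n] × s) ⊆ {‖y‖ ≥ R}` (the slab embedding is injective), and (i) applies;
  `tsum_le_of_sum_le'`.
* `tight_seq_decay`: with `R ≈ n/2`, antitonicity gives `(n/2) S_i(n) ≤ Σ_{j=R}^{n} S_i(j) ≤ C(n/2)^{−α}`,
  i.e. `n² S_i(n) ≤ 2^{α+1} C n^{1−α}` for `n ≥ 2R₁+2`; small `n ≥ 1` are absorbed using
  `S_i(n) ≤ Σ'|m|`.  So `n² S_i(n) ≤ D n^{1−α}` for all `n ≥ 1`.
* `tight_box_coord_moment`: fibre `B_R` by `t = y_i ∈ [−R, R]`; on the fibre `y_i = t ≠ 0` the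
  points are `insertNth i t y⊥`, and by sign-flip invariance `m(insertNth i t y⊥) = m(insertNth i |t| y⊥)`,
  so `Σ_{fibre} m ≤ S_i(|t|)` (`tight_fiber_le_slab`) and `Σ_{y∈B_R} m(y) y_i² ≤ Σ_t t² S_i(|t|) ≤
  D Σ_{t=−R}^{R} |t|^{1−α} ≤ 2D R^{2−α}/(2−α)` (`tight_sum_Icc_abs_rpow` of the auxiliary file).
* Summing over the three coordinates gives (ii) with `C' = 6(D₀+D₁+D₂)/(2−α)`.

Pure theorem file, no definitions, no `sorry`.  References: A. Messager, S. Miracle-Solé,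
J. Stat. Phys. 17 (1977) 245 (box capture, a hypothesis here); the antitone slab sums come, in the
application, from reflection positivity + Pick inversion (landed elsewhere); everything proved in
this file is elementary [folklore].
-/

noncomputable section

namespace Summit.CriticalPhenomena.Ising3DConformalLimit.Cruxes.DirectCorrelationStableTail.DiffusiveBranchIsNonsaturation

open Filter Topology
open scoped BigOperators
open Literature.Probability.LatticeModels

/-! ### Slab sums -/

/-- The slab embedding `y⊥ ↦ insertNth i j y⊥ : ℤ² → ℤ³` is injective. [folklore] -/
theorem tight_insertNth_right_injective (i : Fin 3) (j : ℤ) :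
    Function.Injective fun y : Fin 2 → ℤ => (Fin.insertNth i j (y) : Site 3) :=
  fun _ _ h => (Fin.insertNth_inj.1 h).2

/-- Summability of the slab sections `y⊥ ↦ m(insertNth i j y⊥)` of an `ℓ¹` function. [folklore] -/
theorem tight_summable_slab {m : Site 3 → ℝ} (hm : Summable m) (i : Fin 3) (j : ℤ) :
    Summable fun y : Fin 2 → ℤ => m (Fin.insertNth i j (y) : Site 3) :=
  hm.comp_injective (tight_insertNth_right_injective i j)

/-- A slab point with nonzero height is not the origin. [folklore] -/
theorem tight_insertNth_ne_zero (i : Fin 3) {j : ℤ} (hj : j ≠ 0) (y : Fin 2 → ℤ) :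
    (Fin.insertNth i j (y) : Site 3) ≠ 0 := by
  -- adapted from `insertNth_ne_zero` (ScaleRegularityAux4, foreign line; re-proved)
  intro h
  have := congrFun h i
  rw [Fin.insertNth_apply_same] at this
  exact hj this

/-- Slab sums at nonzero height are nonnegative when `m ≥ 0` off the origin. [folklore] -/
theorem tight_slab_nonneg {m : Site 3 → ℝ} (hnn : ∀ y, y ≠ 0 → 0 ≤ m y) (i : Fin 3) {j : ℤ}
    (hj : j ≠ 0) : 0 ≤ ∑' y : Fin 2 → ℤ, m (Fin.insertNth i j (y) : Site 3) :=
  tsum_nonneg fun y => hnn _ (tight_insertNth_ne_zero i hj y)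

/-- Crude bound: every slab sum is at most `Σ' |m|`. [folklore] -/
theorem tight_slab_le_tsum_abs {m : Site 3 → ℝ} (hm : Summable m) (i : Fin 3) (j : ℤ) :
    (∑' y : Fin 2 → ℤ, m (Fin.insertNth i j (y) : Site 3)) ≤ ∑' y, |m y| :=
  Summable.tsum_le_tsum_of_inj (f := fun y : Fin 2 → ℤ => m (Fin.insertNth i j (y) : Site 3))
    (fun y : Fin 2 → ℤ => (Fin.insertNth i j (y) : Site 3)) (tight_insertNth_right_injective i j)
    (fun _ _ => abs_nonneg _) (fun _ => le_abs_self _) (tight_summable_slab hm i j) hm.abs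

/-- **Slab block bound from tightness at infinity.**  If `R^α Σ_{y ∈ T} m(y) ≤ C` for every
finite `T ⊆ {‖y‖ ≥ R}` (`R ≥ R₁`), then `Σ_{j=R}^{n} S_i(j) ≤ C / R^α` for the slab sums
`S_i(j) = Σ_{y⊥ ∈ ℤ²} m(insertNth i j y⊥)`, `R ≥ max(R₁, 1)`: every finite piece of the double sum
is a sum of `m` over a finite subset of `{‖y‖ ≥ R}`. [folklore] -/
theorem tight_slab_block {m : Site 3 → ℝ} {α C : ℝ} {R₁ : ℕ} (hm : Summable m) (hC0 : 0 ≤ C)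
    (hC : ∀ R : ℕ, R₁ ≤ R → ∀ T : Finset (Site 3), (∀ y ∈ T, (R : ℝ) ≤ ‖y‖) →
      (R : ℝ) ^ α * ∑ y ∈ T, m y ≤ C)
    (i : Fin 3) {R : ℕ} (n : ℕ) (hR : R₁ ≤ R) (hR1 : 1 ≤ R) :
    ∑ j ∈ Finset.Icc R n, (∑' y : Fin 2 → ℤ, m (Fin.insertNth i (j : ℤ) (y) : Site 3)) ≤
      C / (R : ℝ) ^ α := by
  have hRα : 0 < (R : ℝ) ^ α := Real.rpow_pos_of_pos (by exact_mod_cast hR1) α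
  rw [← Summable.tsum_finsetSum (fun (j : ℕ) _ => tight_summable_slab hm i (j : ℤ))]
  refine tsum_le_of_sum_le' (div_nonneg hC0 hRα.le) fun s => ?_
  have hinj : Set.InjOn (fun p : ℕ × (Fin 2 → ℤ) => (Fin.insertNth i (p.1 : ℤ) (p.2) : Site 3))
      ↑(Finset.Icc R n ×ˢ s) := by
    intro p _ q _ h
    have h' := Fin.insertNth_inj.1 h
    exact Prod.ext (by exact_mod_cast h'.1) h'.2
  have hTsum : ∑ y ∈ (Finset.Icc R n ×ˢ s).image
      (fun p : ℕ × (Fin 2 → ℤ) => (Fin.insertNth i (p.1 : ℤ) (p.2) : Site 3)), m y =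
      ∑ y ∈ s, ∑ j ∈ Finset.Icc R n, m (Fin.insertNth i (j : ℤ) (y) : Site 3) := by
    rw [Finset.sum_image hinj, Finset.sum_product, Finset.sum_comm]
  have hTfar : ∀ y ∈ (Finset.Icc R n ×ˢ s).image
      (fun p : ℕ × (Fin 2 → ℤ) => (Fin.insertNth i (p.1 : ℤ) (p.2) : Site 3)), (R : ℝ) ≤ ‖y‖ := by
    intro y hy
    rw [Finset.mem_image] at hy
    obtain ⟨p, hp, rfl⟩ := hy
    rw [Finset.mem_product, Finset.mem_Icc] at hp
    calc (R : ℝ) ≤ (p.1 : ℝ) := by exact_mod_cast hp.1.1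
      _ = ‖(Fin.insertNth i (p.1 : ℤ) (p.2) : Site 3) i‖ := by
          rw [Fin.insertNth_apply_same, Int.norm_natCast]
      _ ≤ ‖(Fin.insertNth i (p.1 : ℤ) (p.2) : Site 3)‖ := norm_le_pi_norm _ i
  have h := hC R hR _ hTfar
  rw [← hTsum, le_div_iff₀ hRα]
  linarith

/-- Iterating an antitone step: `S(n) ≤ S(j)` for `1 ≤ j ≤ n`. [folklore] -/
theorem tight_chain {S : ℕ → ℝ} (hanti : ∀ n, 1 ≤ n → S (n + 1) ≤ S n) {j n : ℕ} (hj : 1 ≤ j)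
    (hjn : j ≤ n) : S n ≤ S j := by
  induction n, hjn using Nat.le_induction with
  | base => exact le_rfl
  | succ n hjn ih => exact (hanti n (le_trans hj hjn)).trans ih

/-- **Decay of an antitone sequence with power-bounded blocks.**  If `S ≥ 0` on `n ≥ 1`, `S ≤ B`,
`S(n+1) ≤ S(n)` for `n ≥ 1`, and `Σ_{j=R}^{n} S(j) ≤ C / R^α` for `R ≥ max(R₁,1)`, then
`n² S(n) ≤ D n^{1−α}` for all `n ≥ 1` (`α ≥ 1`): for large `n` take `R ≈ n/2`, so that
`(n/2) S(n) ≤ Σ_{j=R}^{n} S(j) ≤ C (n/2)^{−α}`; small `n` are absorbed by `B`. [folklore] -/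
theorem tight_seq_decay {S : ℕ → ℝ} {α B C : ℝ} {R₁ : ℕ} (hα1 : 1 ≤ α) (hB0 : 0 ≤ B) (hC0 : 0 ≤ C)
    (hR₁ : 1 ≤ R₁) (hS0 : ∀ n, 1 ≤ n → 0 ≤ S n) (hSB : ∀ n, S n ≤ B)
    (hanti : ∀ n, 1 ≤ n → S (n + 1) ≤ S n)
    (hblock : ∀ R n : ℕ, R₁ ≤ R → 1 ≤ R → ∑ j ∈ Finset.Icc R n, S j ≤ C / (R : ℝ) ^ α) :
    ∃ D : ℝ, 0 ≤ D ∧ ∀ n : ℕ, 1 ≤ n → (n : ℝ) ^ 2 * S n ≤ D * (n : ℝ) ^ (1 - α) := by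
  have hα0 : 0 ≤ α := by linarith
  -- large `n`
  have hlarge : ∀ n : ℕ, 2 * R₁ + 2 ≤ n →
      (n : ℝ) ^ 2 * S n ≤ 2 ^ (α + 1) * C * (n : ℝ) ^ (1 - α) := by
    intro n hn
    obtain ⟨R, hRdef⟩ : ∃ R : ℕ, R = (n + 1) / 2 := ⟨_, rfl⟩
    have hR₁R : R₁ ≤ R := by omega
    have hR1 : 1 ≤ R := by omega
    have h2R : n ≤ 2 * R := by omega
    have hcnt : n ≤ 2 * (n + 1 - R) := by omega
    have hnpos : (0 : ℝ) < n := by exact_mod_cast (show 0 < n by omega)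
    -- `(n + 1 - R) S(n) ≤ Σ_{j=R}^{n} S(j) ≤ C / R^α`
    have hcount : ((n + 1 - R : ℕ) : ℝ) * S n ≤ C / (R : ℝ) ^ α := by
      have h1 : (Finset.Icc R n).card • S n ≤ ∑ j ∈ Finset.Icc R n, S j :=
        Finset.card_nsmul_le_sum _ _ _ fun j hj => by
          rw [Finset.mem_Icc] at hj
          exact tight_chain hanti (le_trans hR1 hj.1) hj.2
      rw [Nat.card_Icc, nsmul_eq_mul] at h1
      exact h1.trans (hblock R n hR₁R hR1)
    have hRpos : (0 : ℝ) < R := by exact_mod_cast hR1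
    have hRα : 0 < (R : ℝ) ^ α := Real.rpow_pos_of_pos hRpos α
    have hnR : (n : ℝ) / 2 ≤ R := by
      have : (n : ℝ) ≤ 2 * R := by exact_mod_cast h2R
      linarith
    have hRαle : ((n : ℝ) / 2) ^ α ≤ (R : ℝ) ^ α := Real.rpow_le_rpow (by positivity) hnR hα0
    have hcnt' : (n : ℝ) / 2 ≤ ((n + 1 - R : ℕ) : ℝ) := by
      have : (n : ℝ) ≤ 2 * ((n + 1 - R : ℕ) : ℝ) := by exact_mod_cast hcnt
      linarith
    have hSn := hS0 n (by omega)
    have hkey : (n : ℝ) / 2 * S n * ((n : ℝ) / 2) ^ α ≤ C := by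
      have h1 : (n : ℝ) / 2 * S n ≤ C / (R : ℝ) ^ α :=
        (mul_le_mul_of_nonneg_right hcnt' hSn).trans hcount
      rw [le_div_iff₀ hRα] at h1
      calc (n : ℝ) / 2 * S n * ((n : ℝ) / 2) ^ α ≤ (n : ℝ) / 2 * S n * (R : ℝ) ^ α :=
            mul_le_mul_of_nonneg_left hRαle (by positivity)
        _ ≤ C := h1
    rw [Real.div_rpow hnpos.le (by norm_num : (0 : ℝ) ≤ 2)] at hkey
    have h2α : 0 < (2 : ℝ) ^ α := Real.rpow_pos_of_pos (by norm_num) α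
    have hnα : 0 < (n : ℝ) ^ α := Real.rpow_pos_of_pos hnpos α
    have hkey' : (n : ℝ) * S n * (n : ℝ) ^ α ≤ 2 * 2 ^ α * C := by
      have e : (n : ℝ) / 2 * S n * ((n : ℝ) ^ α / 2 ^ α) =
          (n : ℝ) * S n * (n : ℝ) ^ α / (2 * 2 ^ α) := by
        field_simp
      rw [e, div_le_iff₀ (by positivity)] at hkey
      linarith
    have e1 : (n : ℝ) ^ (1 - α) = n / (n : ℝ) ^ α := by
      rw [Real.rpow_sub hnpos, Real.rpow_one]
    have e2 : (2 : ℝ) ^ (α + 1) = 2 ^ α * 2 := Real.rpow_add_one two_ne_zero α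
    rw [e1, e2, mul_div_assoc', le_div_iff₀ hnα]
    calc (n : ℝ) ^ 2 * S n * (n : ℝ) ^ α = n * ((n : ℝ) * S n * (n : ℝ) ^ α) := by ring
      _ ≤ n * (2 * 2 ^ α * C) := mul_le_mul_of_nonneg_left hkey' hnpos.le
      _ = 2 ^ α * 2 * C * n := by ring
  -- small `n`
  have hN₀pos : (0 : ℝ) < ((2 * R₁ + 2 : ℕ) : ℝ) := by positivity
  have hN₀α : 0 < ((2 * R₁ + 2 : ℕ) : ℝ) ^ (1 - α) := Real.rpow_pos_of_pos hN₀pos _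
  have hD₂0 : 0 ≤ ((2 * R₁ + 2 : ℕ) : ℝ) ^ 2 * B / ((2 * R₁ + 2 : ℕ) : ℝ) ^ (1 - α) := by
    positivity
  have hsmall : ∀ n : ℕ, 1 ≤ n → n < 2 * R₁ + 2 → (n : ℝ) ^ 2 * S n ≤
      ((2 * R₁ + 2 : ℕ) : ℝ) ^ 2 * B / ((2 * R₁ + 2 : ℕ) : ℝ) ^ (1 - α) * (n : ℝ) ^ (1 - α) := by
    intro n hn hnN
    have hnpos : (0 : ℝ) < n := by exact_mod_cast hn
    have hnN' : (n : ℝ) ≤ ((2 * R₁ + 2 : ℕ) : ℝ) := by exact_mod_cast hnN.le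
    have h1 : (n : ℝ) ^ 2 * S n ≤ ((2 * R₁ + 2 : ℕ) : ℝ) ^ 2 * B := by
      have hsq : (n : ℝ) ^ 2 ≤ ((2 * R₁ + 2 : ℕ) : ℝ) ^ 2 := pow_le_pow_left₀ hnpos.le hnN' 2
      calc (n : ℝ) ^ 2 * S n ≤ ((2 * R₁ + 2 : ℕ) : ℝ) ^ 2 * S n :=
            mul_le_mul_of_nonneg_right hsq (hS0 n hn)
        _ ≤ ((2 * R₁ + 2 : ℕ) : ℝ) ^ 2 * B := mul_le_mul_of_nonneg_left (hSB n) (by positivity)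
    have h2 : ((2 * R₁ + 2 : ℕ) : ℝ) ^ (1 - α) ≤ (n : ℝ) ^ (1 - α) :=
      Real.rpow_le_rpow_of_nonpos hnpos hnN' (by linarith)
    calc (n : ℝ) ^ 2 * S n ≤ ((2 * R₁ + 2 : ℕ) : ℝ) ^ 2 * B := h1
      _ = ((2 * R₁ + 2 : ℕ) : ℝ) ^ 2 * B / ((2 * R₁ + 2 : ℕ) : ℝ) ^ (1 - α) *
            ((2 * R₁ + 2 : ℕ) : ℝ) ^ (1 - α) := by rw [div_mul_cancel₀ _ hN₀α.ne']
      _ ≤ ((2 * R₁ + 2 : ℕ) : ℝ) ^ 2 * B / ((2 * R₁ + 2 : ℕ) : ℝ) ^ (1 - α) * (n : ℝ) ^ (1 - α) :=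
            mul_le_mul_of_nonneg_left h2 hD₂0
  -- together
  have h2C : 0 ≤ 2 ^ (α + 1) * C := by positivity
  refine ⟨2 ^ (α + 1) * C + ((2 * R₁ + 2 : ℕ) : ℝ) ^ 2 * B / ((2 * R₁ + 2 : ℕ) : ℝ) ^ (1 - α),
    by positivity, fun n hn => ?_⟩
  have hnα : 0 ≤ (n : ℝ) ^ (1 - α) := Real.rpow_nonneg (Nat.cast_nonneg n) _
  rcases le_or_gt (2 * R₁ + 2) n with h | h
  · calc (n : ℝ) ^ 2 * S n ≤ 2 ^ (α + 1) * C * (n : ℝ) ^ (1 - α) := hlarge n h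
      _ ≤ _ := by nlinarith
  · calc (n : ℝ) ^ 2 * S n ≤ _ := hsmall n hn h
      _ ≤ _ := by nlinarith

/-! ### Fibers of a box and the truncated second moment -/

/-- **Fiber sums are bounded by slab sums.**  If `m ≥ 0` off `0` is invariant under the coordinate
sign flips, then for `t ≠ 0` and a finite set `s ⊆ {y_i = t}`:
`Σ_{y ∈ s} m(y) ≤ S_i(|t|) = Σ_{y⊥ ∈ ℤ²} m(insertNth i |t| y⊥)` (re-insert the `i`-th coordinate,
flipping its sign if `t < 0`). [folklore] -/
theorem tight_fiber_le_slab {m : Site 3 → ℝ} (hm : Summable m) (hnn : ∀ y, y ≠ 0 → 0 ≤ m y)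
    (hflip : ∀ (j : Fin 3) (y : Site 3), m (Function.update y j (-y j)) = m y)
    (i : Fin 3) {t : ℤ} (ht : t ≠ 0) (s : Finset (Site 3)) (hs : ∀ y ∈ s, y i = t) :
    ∑ y ∈ s, m y ≤ ∑' y : Fin 2 → ℤ, m (Fin.insertNth i ((t.natAbs : ℕ) : ℤ) (y) : Site 3) := by
  have htabs : ((t.natAbs : ℕ) : ℤ) ≠ 0 := by omega
  -- re-inserting the `i`-th coordinate
  have hrepr : ∀ y ∈ s,
      m (Fin.insertNth i ((t.natAbs : ℕ) : ℤ) (Fin.removeNth i y) : Site 3) = m y := by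
    intro y hy
    have hyi := hs y hy
    rcases le_or_gt 0 t with h | h
    · have h1 : ((t.natAbs : ℕ) : ℤ) = y i := by rw [hyi]; omega
      rw [h1, Fin.insertNth_self_removeNth]
    · have h2 : ((t.natAbs : ℕ) : ℤ) = -y i := by rw [hyi]; omega
      rw [h2, Fin.insertNth_removeNth, hflip]
  have hinj : Set.InjOn (fun y : Site 3 => (Fin.removeNth i y : Fin 2 → ℤ)) ↑s := by
    intro y hy y' hy' h
    calc y = Fin.insertNth i (y i) (Fin.removeNth i y) := (Fin.insertNth_self_removeNth i y).symm
      _ = Fin.insertNth i (y' i) (Fin.removeNth i y') := by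
          rw [hs y hy, hs y' hy']
          exact congrArg _ h
      _ = y' := Fin.insertNth_self_removeNth i y'
  calc ∑ y ∈ s, m y
      = ∑ y ∈ s, m (Fin.insertNth i ((t.natAbs : ℕ) : ℤ) (Fin.removeNth i y) : Site 3) :=
        Finset.sum_congr rfl fun y hy => (hrepr y hy).symm
    _ = ∑ y ∈ s.image (fun y : Site 3 => (Fin.removeNth i y : Fin 2 → ℤ)),
          m (Fin.insertNth i ((t.natAbs : ℕ) : ℤ) (y) : Site 3) :=
        (Finset.sum_image (f := fun y => m (Fin.insertNth i ((t.natAbs : ℕ) : ℤ) (y) : Site 3))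
          hinj).symm
    _ ≤ ∑' y : Fin 2 → ℤ, m (Fin.insertNth i ((t.natAbs : ℕ) : ℤ) (y) : Site 3) :=
        (tight_summable_slab hm i _).sum_le_tsum _ fun y _ =>
          hnn _ (tight_insertNth_ne_zero i htabs y)

/-- **Truncated second moment in one coordinate.**  If `m ≥ 0` off `0` is sign-flip invariant and
its slab sums decay as `n² S_i(n) ≤ D n^{1−α}` (`n ≥ 1`, `1 < α < 2`), then
`Σ_{y ∈ B_R} m(y) y_i² ≤ D · 2R^{2−α}/(2−α)`: fibre the box by `t = y_i ∈ [−R, R]`, bound each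
fibre by the slab sum `S_i(|t|)` and sum `|t|^{1−α}`. [folklore] -/
theorem tight_box_coord_moment {m : Site 3 → ℝ} {α D : ℝ} (hm : Summable m)
    (hnn : ∀ y, y ≠ 0 → 0 ≤ m y)
    (hflip : ∀ (j : Fin 3) (y : Site 3), m (Function.update y j (-y j)) = m y)
    (hα1 : 1 < α) (hα2 : α < 2) (hD0 : 0 ≤ D) (i : Fin 3)
    (hdec : ∀ n : ℕ, 1 ≤ n → (n : ℝ) ^ 2 *
      (∑' y : Fin 2 → ℤ, m (Fin.insertNth i (n : ℤ) (y) : Site 3)) ≤ D * (n : ℝ) ^ (1 - α))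
    (R : ℕ) :
    ∑ y ∈ box 3 R, m y * ((y i : ℝ)) ^ 2 ≤ D * (2 * (R : ℝ) ^ (2 - α) / (2 - α)) := by
  have hmaps : ∀ y ∈ box 3 R, y i ∈ Finset.Icc (-(R : ℤ)) R := fun y hy => by
    rw [Finset.mem_Icc]
    exact (mem_box.1 hy) i
  rw [← Finset.sum_fiberwise_of_maps_to hmaps]
  have hfib : ∀ t ∈ Finset.Icc (-(R : ℤ)) R,
      ∑ y ∈ box 3 R with y i = t, m y * ((y i : ℝ)) ^ 2 ≤ D * |(t : ℝ)| ^ (1 - α) := by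
    intro t _
    have hcongr : ∑ y ∈ box 3 R with y i = t, m y * ((y i : ℝ)) ^ 2 =
        (∑ y ∈ box 3 R with y i = t, m y) * (t : ℝ) ^ 2 := by
      rw [Finset.sum_mul]
      refine Finset.sum_congr rfl fun y hy => ?_
      rw [(Finset.mem_filter.1 hy).2]
    rw [hcongr]
    by_cases ht : t = 0
    · rw [ht, Int.cast_zero, abs_zero, Real.zero_rpow (sub_neg.2 hα1).ne]
      simp
    · have hfiber := tight_fiber_le_slab hm hnn hflip i ht (box 3 R |>.filter fun y => y i = t)
        (fun y hy => (Finset.mem_filter.1 hy).2)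
      have hn1 : 1 ≤ t.natAbs := by omega
      have hd := hdec t.natAbs hn1
      have hcast : ((t.natAbs : ℕ) : ℝ) = |(t : ℝ)| := by
        rw [Nat.cast_natAbs, Int.cast_abs]
      rw [hcast, sq_abs] at hd
      calc (∑ y ∈ box 3 R with y i = t, m y) * (t : ℝ) ^ 2
          ≤ (∑' y : Fin 2 → ℤ, m (Fin.insertNth i ((t.natAbs : ℕ) : ℤ) (y) : Site 3)) *
              (t : ℝ) ^ 2 := mul_le_mul_of_nonneg_right hfiber (sq_nonneg _)
        _ = (t : ℝ) ^ 2 * ∑' y : Fin 2 → ℤ, m (Fin.insertNth i ((t.natAbs : ℕ) : ℤ) (y) : Site 3) :=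
              mul_comm _ _
        _ ≤ D * |(t : ℝ)| ^ (1 - α) := hd
  calc ∑ t ∈ Finset.Icc (-(R : ℤ)) R, ∑ y ∈ box 3 R with y i = t, m y * ((y i : ℝ)) ^ 2
      ≤ ∑ t ∈ Finset.Icc (-(R : ℤ)) R, D * |(t : ℝ)| ^ (1 - α) := Finset.sum_le_sum hfib
    _ = D * ∑ t ∈ Finset.Icc (-(R : ℤ)) R, |(t : ℝ)| ^ (1 - α) := by rw [Finset.mul_sum]
    _ ≤ D * (2 * (R : ℝ) ^ (2 - α) / (2 - α)) :=
        mul_le_mul_of_nonneg_left (tight_sum_Icc_abs_rpow hα1 hα2 R) hD0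

/-! ### Tightness at zero -/

/-- **Tightness at zero (truncated second moment).**  If `m ∈ ℓ¹(ℤ³)`, `m ≥ 0` off `0`, `m` is
sign-flip invariant with antitone slab sums `S_i(n+1) ≤ S_i(n)` (`n ≥ 1`), `1 < α < 2`, and
`R^α Σ_{y∈T} m(y) ≤ C` for finite `T ⊆ {‖y‖ ≥ R}`, `R ≥ R₁ ≥ 1`, then
`Σ_{y ∈ B_R} m(y)|y|₂² ≤ C' R^{2−α}` for all `R`.  Proof: the slab block bound and antitonicity give
`n² S_i(n) ≤ D n^{1−α}` (`tight_seq_decay`), and the box moment is the sum over the three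
coordinates of `tight_box_coord_moment`. [folklore] -/
theorem tight_atZero {m : Site 3 → ℝ} {α C : ℝ} {R₁ : ℕ} (hm : Summable m)
    (hnn : ∀ y, y ≠ 0 → 0 ≤ m y)
    (hflip : ∀ (j : Fin 3) (y : Site 3), m (Function.update y j (-y j)) = m y)
    (hanti : ∀ (i : Fin 3) (n : ℕ), 1 ≤ n →
      (∑' y : Fin 2 → ℤ, m (Fin.insertNth i ((n + 1 : ℕ) : ℤ) (y) : Site 3)) ≤
        ∑' y : Fin 2 → ℤ, m (Fin.insertNth i (n : ℤ) (y) : Site 3))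
    (hα1 : 1 < α) (hα2 : α < 2) (hC0 : 0 ≤ C) (hR₁ : 1 ≤ R₁)
    (hC : ∀ R : ℕ, R₁ ≤ R → ∀ T : Finset (Site 3), (∀ y ∈ T, (R : ℝ) ≤ ‖y‖) →
      (R : ℝ) ^ α * ∑ y ∈ T, m y ≤ C) :
    ∃ C' : ℝ, ∀ R : ℕ, ∑ y ∈ box 3 R, m y * (∑ i, ((y i : ℝ)) ^ 2) ≤ C' * (R : ℝ) ^ (2 - α) := by
  -- slab decay in each of the three directions
  have hB0 : 0 ≤ ∑' y, |m y| := tsum_nonneg fun y => abs_nonneg _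
  have hdec : ∀ i : Fin 3, ∃ D : ℝ, 0 ≤ D ∧ ∀ n : ℕ, 1 ≤ n → (n : ℝ) ^ 2 *
      (∑' y : Fin 2 → ℤ, m (Fin.insertNth i (n : ℤ) (y) : Site 3)) ≤ D * (n : ℝ) ^ (1 - α) :=
    fun i => tight_seq_decay (S := fun n : ℕ => ∑' y : Fin 2 → ℤ, m (Fin.insertNth i (n : ℤ) (y) : Site 3))
      hα1.le hB0 hC0 hR₁
      (fun n hn => tight_slab_nonneg hnn i (by exact_mod_cast (show n ≠ 0 by omega)))
      (fun n => tight_slab_le_tsum_abs hm i (n : ℤ)) (hanti i)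
      (fun R n hR hR1 => tight_slab_block hm hC0 hC i n hR hR1)
  choose D hD0 hD using hdec
  have hDle : ∀ i, D i ≤ ∑ j, D j := fun i =>
    Finset.single_le_sum (f := D) (fun j _ => hD0 j) (Finset.mem_univ i)
  have hDm0 : 0 ≤ ∑ j, D j := Finset.sum_nonneg fun j _ => hD0 j
  have h2α : 0 < 2 - α := by linarith
  refine ⟨3 * ((∑ j, D j) * (2 / (2 - α))), fun R => ?_⟩
  have hcoord : ∀ i : Fin 3,
      ∑ y ∈ box 3 R, m y * ((y i : ℝ)) ^ 2 ≤ (∑ j, D j) * (2 * (R : ℝ) ^ (2 - α) / (2 - α)) :=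
    fun i => tight_box_coord_moment hm hnn hflip hα1 hα2 hDm0 i
      (fun n hn => (hD i n hn).trans
        (mul_le_mul_of_nonneg_right (hDle i) (Real.rpow_nonneg (Nat.cast_nonneg n) _))) R
  calc ∑ y ∈ box 3 R, m y * (∑ i, ((y i : ℝ)) ^ 2)
      = ∑ y ∈ box 3 R, ∑ i, m y * ((y i : ℝ)) ^ 2 :=
        Finset.sum_congr rfl fun y _ => Finset.mul_sum _ _ _
    _ = ∑ i : Fin 3, ∑ y ∈ box 3 R, m y * ((y i : ℝ)) ^ 2 := Finset.sum_comm
    _ ≤ ∑ _i : Fin 3, (∑ j, D j) * (2 * (R : ℝ) ^ (2 - α) / (2 - α)) :=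
        Finset.sum_le_sum fun i _ => hcoord i
    _ = 3 * ((∑ j, D j) * (2 / (2 - α))) * (R : ℝ) ^ (2 - α) := by
        rw [Finset.sum_const, Finset.card_univ, Fintype.card_fin, nsmul_eq_mul]
        push_cast
        ring

/-! ### The registered stub -/

/-- **Stub S1 `stub_tightness`.**  Let `m ∈ ℓ¹(ℤ³)`, `Σ m = 0`, `m ≥ 0` off `0`, `m` invariant under the coordinate sign flips,
with antitone slab sums `S_i(n+1) ≤ S_i(n)` (`n ≥ 1`, `S_i(n) = Σ_{y ∈ ℤ²} m(insertNth i n y)`), the precision identity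
`Σ_y m(y) G(z − y) = −δ_{z0}`, box capture `Σ_{z∈B_R} G(z+v) ≤ Σ_{z∈B_R} G(z)`, `G ≥ 0`, and the scale bounds
`G(x) ≤ C₁‖x‖^{α−3}` (`x ≠ 0`), `c₁‖x‖^{α−3} ≤ G(x)` (`‖x‖ ≥ R₀`), `1 < α < 2`.  Then (i) `R^α Σ_{y∈T} m(y) ≤ C` for every
finite `T ⊆ {‖y‖ ≥ R}`, `R ≥ R₁` (`tight_atInfinity`: flux identity + box capture + scale bounds); (ii)
`Σ_{y ∈ B_R} m(y)|y|₂² ≤ C' R^{2−α}` for `R ≥ 1` (`tight_atZero`: (i) on slabs + antitone slab sums). [folklore] -/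
theorem stub_tightness :
    ∀ (m G : Site 3 → ℝ) (α c₁ C₁ : ℝ) (R₀ : ℕ),
      Summable m → (∑' y, m y) = 0 → (∀ y, y ≠ 0 → 0 ≤ m y) →
      (∀ (j : Fin 3) (y : Site 3), m (Function.update y j (-y j)) = m y) →
      (∀ (i : Fin 3) (n : ℕ), 1 ≤ n → (∑' y : Fin 2 → ℤ, m (Fin.insertNth i ((n + 1 : ℕ) : ℤ) (y) : Site 3)) ≤
        ∑' y : Fin 2 → ℤ, m (Fin.insertNth i (n : ℤ) (y) : Site 3)) →
      (∀ z : Site 3, (∑' y, m y * G (z - y)) = if z = 0 then -1 else 0) →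
      (∀ (R : ℕ) (v : Site 3), ∑ z ∈ box 3 R, G (z + v) ≤ ∑ z ∈ box 3 R, G z) →
      (∀ x, 0 ≤ G x) → 1 < α → α < 2 → 0 < c₁ →
      (∀ x : Site 3, x ≠ 0 → G x ≤ C₁ * ‖x‖ ^ (α - 3)) →
      (∀ x : Site 3, (R₀ : ℝ) ≤ ‖x‖ → c₁ * ‖x‖ ^ (α - 3) ≤ G x) →
      ∃ (C C' : ℝ) (R₁ : ℕ),
        (∀ R : ℕ, R₁ ≤ R → ∀ T : Finset (Site 3), (∀ y ∈ T, (R : ℝ) ≤ ‖y‖) →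
          (R : ℝ) ^ α * ∑ y ∈ T, m y ≤ C) ∧
        (∀ R : ℕ, 1 ≤ R → ∑ y ∈ box 3 R, m y * (∑ i, ((y i : ℝ)) ^ 2) ≤ C' * (R : ℝ) ^ (2 - α)) := by
  intro m G α c₁ C₁ R₀ hm hzero hnn hflip hanti hconv hcap hG0 hα1 hα2 hc₁ hup hlo
  obtain ⟨C, R₁, hC0, hR₁, hC⟩ :=
    tight_atInfinity hm hzero hnn hconv hcap hG0 (by linarith) (by linarith) hc₁ hup hlo
  obtain ⟨C', hC'⟩ := tight_atZero hm hnn hflip hanti hα1 hα2 hC0 hR₁ hC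
  exact ⟨C, C', R₁, hC, fun R _ => hC' R⟩

end Summit.CriticalPhenomena.Ising3DConformalLimit.Cruxes.DirectCorrelationStableTail.DiffusiveBranchIsNonsaturation

end
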